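import Mathlib
import Literature.AlgebraicGeometry.Resolution.DedekindOverring
import Literature.AlgebraicGeometry.Resolution.QuadraticSequenceDimOneExistence
import Literature.AlgebraicGeometry.Resolution.BlowupPointSubalgebra
import HarnessLib

/-!
# Quadratic transforms of a one-dimensional local domain: finiteness, branches, `δ`-drop

Topic: `Literature/AlgebraicGeometry/Resolution`. Ring-level form, inside the fraction field `K`,
of the resolution of curve singularities by blowing up (Krull 1930, Satz 7; Kollár 2007, §1.4 and
Thm. 1.101): for a one-dimensional Noetherian local domain `D ⊆ K` (`QF(D) = K`) with finite
normalization `D̄`, and its **quadratic transforms** `S = (D[𝔪_D/x])_𝔫 ⊆ K` (`IsQuadraticTransform`,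
`QuadraticTransforms.lean`: `𝔫` a prime over `𝔪_D`; these are the local rings of the blowing up
`Bl_𝔪 Spec D` at its points over the closed point):

* `IsQuadraticTransform.not_isField'`, `….isNoetherianRing`, `….ringKrullDim_eq_one`,
  `….module_finite_integralClosure` — every quadratic transform is again a one-dimensional
  Noetherian local domain of `K` with finite normalization (Krull–Akizuki; normalization
  `S̄ = S[D̄]`, `DedekindOverring.lean`);
* `IsQuadraticTransform.subringDominates_of_le` — a quadratic transform contained in the valuation
  ring of a branch is dominated by it; `IsQuadraticTransform.eq_of_le_valuationSubring` — hence
  **two quadratic transforms inside the same branch valuation ring coincide** (uniqueness of the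
  transform along a valuation), and `exists_isQuadraticTransform_le_valuationSubring` — every
  branch dominates one;
* `isFirstNeighbourhood_quadraticTransform` — the family of ALL quadratic transforms of `D` is a
  first neighbourhood of `D` in the sense of `CurveDeltaDrop.lean`, so that
* `IsQuadraticTransform.curveDelta_lt` — **`δ(S) < δ(D)` for every quadratic transform `S` of a
  non-regular `D`**, and `IsQuadraticTransform.eq_self_of_isDiscreteValuationRing` — a discrete
  valuation ring has no quadratic transform other than itself.

All PROVED; the consumer is the finiteness of Krull's blow-up tower of a one-dimensional local
ring with reduced completion (Kollár 2007, Thm. 1.101; `OneDimensionalBlowupTower.lean`).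

## Sources

* J. Kollár, *Lectures on Resolution of Singularities*, Ann. of Math. Stud. 166 (2007), §1.4,
  Thm. 1.101. [Kollar2007]
* W. Krull, *Ein Satz über primäre Integritätsbereiche*, Math. Ann. 103 (1930), Satz 7 (as cited
  by Kollár). [Kollar2007]
-/

noncomputable section

open IsLocalRing IsDedekindDomain

namespace Literature.AlgebraicGeometry.Resolution

universe u

variable {K : Type u} [Field K]

/-! ## Quadratic transforms of a one-dimensional local domain -/

namespace IsQuadraticTransform

variable {D S : Subring K} [IsLocalRing D]

omit [IsLocalRing D] in
/-- `D ⊆ S`. [cite: Kollar2007, §1.4] -/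
theorem le' (h : IsQuadraticTransform D S) : D ≤ S := h.dominates.1

/-- The element `x` of the quadratic transform `S = D[𝔪/x]_𝔫`: `0 ≠ x ∈ 𝔪_D`, `𝔪_D ⊆ x S`, and
`x` is a non-unit of `S`. [cite: Kollar2007, §1.4] -/
theorem exists_generator (h : IsQuadraticTransform D S) :
    ∃ x : D, x ∈ maximalIdeal D ∧ x ≠ 0 ∧ (∀ y ∈ maximalIdeal D, (y : K) / x ∈ S) ∧
      ((x : K)⁻¹ ∉ S) := by
  obtain ⟨_, x, hx, hx0, hloc, hle, -, hdom⟩ := h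
  refine ⟨x, hx, hx0, fun y hy => hle (div_mem_blowupRing _ hy), fun hinv => ?_⟩
  have hxD : (x : K)⁻¹ ∈ D := hdom.2 x x.2 hinv
  have hx0' : (x : K) ≠ 0 := fun e => hx0 (Subtype.ext e)
  exact hx ((isUnit_subring_iff_inv_mem x).mpr ⟨hx0', hxD⟩) |>.elim

/-- A quadratic transform is not a field. [cite: Kollar2007, §1.4] -/
theorem not_isField' (h : IsQuadraticTransform D S) :
    letI := h.isLocalRing; ¬ IsField S := by
  letI := h.isLocalRing
  obtain ⟨x, -, hx0, -, hinv⟩ := h.exists_generator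
  intro hF
  have hx0' : (x : K) ≠ 0 := fun e => hx0 (Subtype.ext e)
  have hxS : (x : K) ∈ S := h.le' x.2
  letI := hF.toField
  have hu : IsUnit (⟨(x : K), hxS⟩ : S) :=
    isUnit_iff_ne_zero.mpr fun e => hx0' (congrArg Subtype.val e)
  exact hinv ((isUnit_subring_iff_inv_mem _).mp hu).2

/-- The maximal ideal of a quadratic transform is nonzero. [cite: Kollar2007, §1.4] -/
theorem maximalIdeal_ne_bot (h : IsQuadraticTransform D S) :
    letI := h.isLocalRing; maximalIdeal S ≠ ⊥ := by
  letI := h.isLocalRing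
  exact (isField_iff_maximalIdeal_eq).not.mp h.not_isField'

omit [IsLocalRing D] in
/-- A quadratic transform has fraction field `K`. [folklore] -/
private theorem isFractionRing' (hof : IsLocalRingOf D) (h : IsQuadraticTransform D S) :
    IsFractionRing S K :=
  isFractionRing_of_isLocalRingOf_le hof.2 h.le'

variable [IsNoetherianRing D] (hof : IsLocalRingOf D) (hD : ¬ IsField D) (hdim : ringKrullDim D = 1)

omit [IsLocalRing D] in
include hof hD hdim in
/-- A quadratic transform of a one-dimensional Noetherian local domain of `K` is Noetherian
(Krull–Akizuki). [cite: Kollar2007, §1.4] -/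
theorem isNoetherianRing (h : IsQuadraticTransform D S) : IsNoetherianRing S := by
  haveI : Ring.KrullDimLE 1 D := Ring.krullDimLE_iff.mpr hdim.le
  exact isNoetherianRing_of_le hof hD h.le'

omit [IsLocalRing D] in
include hof hD hdim in
/-- … of dimension `≤ 1` (Krull–Akizuki). [cite: Kollar2007, §1.4] -/
theorem dimensionLEOne (h : IsQuadraticTransform D S) : Ring.DimensionLEOne S := by
  haveI : Ring.KrullDimLE 1 D := Ring.krullDimLE_iff.mpr hdim.le
  exact dimensionLEOne_of_le hof hD h.le'

include hof hD hdim in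
/-- … and of dimension exactly `1`. [cite: Kollar2007, §1.4] -/
theorem ringKrullDim_eq_one (h : IsQuadraticTransform D S) : ringKrullDim S = 1 := by
  haveI := h.isLocalRing
  haveI := h.dimensionLEOne hof hD hdim
  have h1 : Ring.KrullDimLE 1 S :=
    Ring.krullDimLE_one_iff_of_isPrime_bot.mpr fun P hP hPp =>
      Ring.DimensionLEOne.maximalOfPrime hP hPp
  have hle : ringKrullDim S ≤ 1 := by exact_mod_cast (Ring.krullDimLE_iff.mp h1)
  have hpos : ¬ ringKrullDim S ≤ 0 := fun h0 => by
    haveI : Ring.KrullDimLE 0 S := Ring.krullDimLE_iff.mpr h0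
    exact h.not_isField' Ring.KrullDimLE.isField_of_isDomain
  exact le_antisymm hle (Order.succ_le_of_lt (lt_of_not_ge hpos))

omit [IsLocalRing D] [IsNoetherianRing D] in
include hof in
/-- **Finite normalization persists**: if the normalization `D̄ ⊆ K` is a Dedekind domain and a
finite `D`-module, then so is the normalization `S̄ = S[D̄]` of every quadratic transform `S` over
`S` (`module_finite_integralClosure_of_le`). [cite: Kollar2007, §1.4] -/
theorem module_finite_integralClosure [IsFractionRing D K]
    [IsDedekindDomain (integralClosure D K)] [Module.Finite D (integralClosure D K)]
    (h : IsQuadraticTransform D S) : Module.Finite S (integralClosure S K) := by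
  haveI : IsFractionRing S K := isFractionRing' hof h
  let T : Subalgebra D K := subalgebraOfLE h.le'
  haveI : IsFractionRing T K := IsFractionRing.of_field T K fun z => by
    obtain ⟨a, ha, b, hb, -, rfl⟩ := hof.2 z
    exact ⟨⟨a, h.le' ha⟩, ⟨b, h.le' hb⟩, rfl⟩
  haveI : Module.Finite T (integralClosure T K) := module_finite_integralClosure_of_le T
  exact module_finite_integralClosure_of_ringEquiv (subalgebraOfLEEquiv h.le') K K

omit [IsLocalRing D] [IsNoetherianRing D] in
include hof in
/-- `S` as a `D`-subalgebra of `K` has fraction field `K`. [folklore] -/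
private theorem isFractionRing_subalgebraOfLE (h : IsQuadraticTransform D S) :
    IsFractionRing (subalgebraOfLE h.le') K :=
  IsFractionRing.of_field _ K fun z => by
    obtain ⟨a, ha, b, hb, -, rfl⟩ := hof.2 z
    exact ⟨⟨a, h.le' ha⟩, ⟨b, h.le' hb⟩, rfl⟩

end IsQuadraticTransform

/-! ## Branches: the valuation rings `D̄_𝔑` -/

section Branch

variable {D : Subring K} [IsDedekindDomain (integralClosure D K)]
  [IsFractionRing (integralClosure D K) K] (v : HeightOneSpectrum (integralClosure D K))

/-- `x ∈ D̄_𝔑` iff `v_𝔑(x) ≤ 1`. [folklore] -/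
private theorem mem_valuationSubringAtPrime_iff_le (x : K) :
    x ∈ v.valuationSubringAtPrime K ↔ v.valuation K x ≤ 1 := by
  rw [HeightOneSpectrum.valuationSubringAtPrime_eq_valuationSubring]
  exact Valuation.mem_valuationSubring_iff _ _

/-- `D ⊆ D̄ ⊆ D̄_𝔑`. [cite: Kollar2007, §1.4] -/
theorem le_valuationSubringAtPrime : D ≤ (v.valuationSubringAtPrime K).toSubring := by
  intro x hx
  have hint : x ∈ integralClosure D K := Subalgebra.algebraMap_mem _ (⟨x, hx⟩ : D)
  change x ∈ v.valuationSubringAtPrime K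
  rw [mem_valuationSubringAtPrime_iff_le]
  exact v.valuation_le_one (⟨x, hint⟩ : integralClosure D K)

variable [IsLocalRing D]

omit [IsFractionRing (integralClosure D K) K] in
/-- A branch `𝔑` of `D` lies over `𝔪_D`. [folklore] -/
private theorem comap_asIdeal_eq_maximalIdeal :
    v.asIdeal.comap (algebraMap D (integralClosure D K)) = maximalIdeal D := by
  haveI : v.asIdeal.IsMaximal := v.isPrime.isMaximal v.ne_bot
  haveI : Algebra.IsIntegral D (integralClosure D K) :=
    ⟨fun x => (isIntegral_algHom_iff (integralClosure D K).val Subtype.val_injective).mp x.2⟩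
  exact IsLocalRing.eq_maximalIdeal
    (Ideal.isMaximal_comap_of_isIntegral_of_isMaximal (R := D) v.asIdeal)

/-- Elements of `𝔪_D` have `v_𝔑`-value `< 1`. [cite: Kollar2007, §1.4] -/
theorem valuation_lt_one_of_mem_maximalIdeal {x : D} (hx : x ∈ maximalIdeal D) :
    v.valuation K (x : K) < 1 := by
  have hint : (x : K) ∈ integralClosure D K := Subalgebra.algebraMap_mem _ x
  have h1 : (⟨(x : K), hint⟩ : integralClosure D K) ∈ v.asIdeal := by
    have h2 : x ∈ v.asIdeal.comap (algebraMap D (integralClosure D K)) := by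
      rw [comap_asIdeal_eq_maximalIdeal]; exact hx
    exact h2
  exact (v.valuation_lt_one_iff_mem (K := K) (⟨(x : K), hint⟩ : integralClosure D K)).mpr h1

/-- **Every branch dominates `D`**: `D̄_𝔑` dominates `D` (`𝔪_{D̄_𝔑} ∩ D = 𝔪_D`). [cite: Kollar2007, §1.4] -/
theorem subringDominates_valuationSubringAtPrime :
    SubringDominates D (v.valuationSubringAtPrime K).toSubring := by
  refine ⟨le_valuationSubringAtPrime v, fun x hx hxinv => ?_⟩
  by_contra hxD
  have hx0 : x ≠ 0 := by
    rintro rfl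
    exact hxD (by rw [inv_zero]; exact D.zero_mem)
  have hxm : (⟨x, hx⟩ : D) ∈ maximalIdeal D :=
    (mem_maximalIdeal_iff_inv_not_mem _).mpr (Or.inr hxD)
  have hlt := valuation_lt_one_of_mem_maximalIdeal v hxm
  have hle : v.valuation K x⁻¹ ≤ 1 := (mem_valuationSubringAtPrime_iff_le v _).mp hxinv
  rw [map_inv₀, inv_le_one₀ (pos_iff_ne_zero.mpr ((map_ne_zero _).mpr hx0))] at hle
  exact not_lt.mpr hle hlt

variable [IsNoetherianRing D]

/-- **Every branch dominates a quadratic transform** (existence half of the valuative criterion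
for the blowing up of the closed point): for `D` Noetherian and not a field there is a quadratic
transform `S ⊆ D̄_𝔑` of `D`. [cite: Kollar2007, §1.4] -/
theorem exists_isQuadraticTransform_le_valuationSubring (hD : ¬ IsField D) :
    ∃ S : Subring K, IsQuadraticTransform D S ∧ S ≤ (v.valuationSubringAtPrime K).toSubring := by
  obtain ⟨S, hS⟩ := exists_isQuadraticTransformAlong (O := v.valuationSubringAtPrime K)
    (le_valuationSubringAtPrime v) ((isField_iff_maximalIdeal_eq).not.mp hD)
  exact ⟨S, hS.isQuadraticTransform (subringDominates_valuationSubringAtPrime v), hS.target_le⟩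

variable (hof : IsLocalRingOf D) (hD : ¬ IsField D) (hdim : ringKrullDim D = 1)

include hof hD hdim in
/-- A quadratic transform `S` contained in the valuation ring of a branch is DOMINATED by it:
the centre of `v_𝔑` on `S` is a nonzero prime (it contains the generator `x`), hence the maximal
ideal of the one-dimensional local domain `S`. [cite: Kollar2007, §1.4] -/
theorem IsQuadraticTransform.subringDominates_of_le {S : Subring K} (h : IsQuadraticTransform D S)
    (hSV : S ≤ (v.valuationSubringAtPrime K).toSubring) :
    SubringDominates S (v.valuationSubringAtPrime K).toSubring := by
  set V := v.valuationSubringAtPrime K with hV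
  haveI := h.isLocalRing
  haveI := h.dimensionLEOne hof hD hdim
  rw [subringDominates_valuationSubring_iff hSV]
  -- the centre of `V` on `S` is the maximal ideal
  obtain ⟨x, hx, hx0, -, -⟩ := h.exists_generator
  have hxS : (x : K) ∈ S := h.le' x.2
  have hx0' : (x : K) ≠ 0 := fun e => hx0 (Subtype.ext e)
  have hxinv : (x : K)⁻¹ ∉ D := fun hmem => hx ((isUnit_subring_iff_inv_mem x).mpr ⟨hx0', hmem⟩)
  have hvx : V.valuation (x : K) < 1 :=
    valuation_lt_one_of_subringDominates (subringDominates_valuationSubringAtPrime v) x.2 hxinv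
  have hP0 : subringCentre S V hSV ≠ ⊥ := by
    intro hbot
    have : (⟨(x : K), hxS⟩ : S) ∈ subringCentre S V hSV := (mem_subringCentre_iff hSV _).mpr hvx
    rw [hbot, Ideal.mem_bot] at this
    exact hx0' (congrArg Subtype.val this)
  have hPmax : subringCentre S V hSV = maximalIdeal S :=
    IsLocalRing.eq_maximalIdeal (Ring.DimensionLEOne.maximalOfPrime hP0 inferInstance)
  intro a
  rw [← hPmax, mem_subringCentre_iff]

include hof hD hdim in
/-- **Uniqueness**: two quadratic transforms of `D` inside the valuation ring of the same branch
coincide (both are the quadratic transform ALONG that valuation, `IsQuadraticTransformAlong.unique`).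
[cite: Kollar2007, §1.4] -/
theorem IsQuadraticTransform.eq_of_le_valuationSubring {S₁ S₂ : Subring K}
    (h₁ : IsQuadraticTransform D S₁) (h₂ : IsQuadraticTransform D S₂)
    (h₁V : S₁ ≤ (v.valuationSubringAtPrime K).toSubring)
    (h₂V : S₂ ≤ (v.valuationSubringAtPrime K).toSubring) : S₁ = S₂ := by
  have hfg : ∃ _ : IsLocalRing D, (maximalIdeal D).FG := ⟨‹_›, IsNoetherian.noetherian _⟩
  exact (h₁.along hfg (h₁.subringDominates_of_le v hof hD hdim h₁V)).unique
    (h₂.along hfg (h₂.subringDominates_of_le v hof hD hdim h₂V))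

end Branch

/-! ## All quadratic transforms form a first neighbourhood; the `δ`-drop -/

section Family

variable {D : Subring K} [IsLocalRing D] [IsNoetherianRing D]
  [IsDedekindDomain (integralClosure D K)] [IsFractionRing (integralClosure D K) K]
  [IsFractionRing D K] [Module.Finite D (integralClosure D K)]
  (hof : IsLocalRingOf D) (hD : ¬ IsField D) (hdim : ringKrullDim D = 1)

include hof hD hdim in
/-- **The quadratic transforms of `D` form a first neighbourhood of `D`** (`CurveDeltaDrop.lean`):
indexed by themselves (as subrings of `K`), they are one-dimensional Noetherian local domains with
finite normalization in which `𝔪_D` becomes principal, and every branch of `D` dominates exactly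
one of them. [cite: Kollar2007, §1.4] -/
theorem isFirstNeighbourhood_quadraticTransform :
    IsFirstNeighbourhood (R := D) (K := K)
      (fun i : {S : Subring K // IsQuadraticTransform D S} => subalgebraOfLE i.2.le') := by
  refine
    { isLocalRing := fun i => ?_
      isNoetherianRing := fun i => ?_
      ringKrullDim_eq_one := fun i => ?_
      module_finite := fun i => ?_
      exists_generator := fun i => ?_
      existsUnique_branch := fun v => ?_ }
  · haveI := i.2.isLocalRing
    exact IsLocalRing.of_surjective' (subalgebraOfLEEquiv i.2.le').symm.toRingHom
      (subalgebraOfLEEquiv i.2.le').symm.surjective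
  · haveI := i.2.isNoetherianRing hof hD hdim
    exact isNoetherianRing_of_ringEquiv _ (subalgebraOfLEEquiv i.2.le').symm
  · rw [ringKrullDim_eq_of_ringEquiv (subalgebraOfLEEquiv i.2.le')]
    exact i.2.ringKrullDim_eq_one hof hD hdim
  · haveI := i.2.module_finite_integralClosure hof
    haveI : IsFractionRing i.1 K := isFractionRing_of_isLocalRingOf_le hof.2 i.2.le'
    haveI := i.2.isFractionRing_subalgebraOfLE hof
    exact module_finite_integralClosure_of_ringEquiv (subalgebraOfLEEquiv i.2.le').symm K K
  · obtain ⟨x, hx, hx0, hdiv, -⟩ := i.2.exists_generator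
    have hx0' : (x : K) ≠ 0 := fun e => hx0 (Subtype.ext e)
    refine ⟨x, hx, fun m hm => ⟨(m : K) / x, hdiv m hm, ?_⟩⟩
    change (m : K) = (x : K) * ((m : K) / x)
    rw [mul_div_cancel₀ _ hx0']
  · obtain ⟨S, hS, hSV⟩ := exists_isQuadraticTransform_le_valuationSubring v hD
    refine ⟨⟨S, hS⟩, fun x hx => (mem_valuationSubringAtPrime_iff_le v x).mp (hSV hx), ?_⟩
    intro j hj
    have hjV : j.1 ≤ (v.valuationSubringAtPrime K).toSubring := fun x hx =>
      (mem_valuationSubringAtPrime_iff_le v x).mpr (hj x hx)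
    exact Subtype.ext (j.2.eq_of_le_valuationSubring v hof hD hdim hS hjV hSV)

include hof hD hdim in
/-- The quadratic transforms of `D` are finite in number (each is dominated by a branch, and
branches through distinct transforms are distinct). [cite: Kollar2007, §1.4] -/
theorem finite_quadraticTransform : Finite {S : Subring K // IsQuadraticTransform D S} := by
  have hFN := isFirstNeighbourhood_quadraticTransform hof hD hdim
  haveI : Finite (HeightOneSpectrum (integralClosure D K)) := finite_heightOneSpectrum D K
  refine Finite.of_injective (fun i => (hFN.exists_branch i).choose) fun i i' hii' => ?_
  have h1 := (hFN.exists_branch i).choose_spec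
  have h2 := (hFN.exists_branch i').choose_spec
  change (hFN.exists_branch i).choose = (hFN.exists_branch i').choose at hii'
  rw [hii'] at h1
  exact hFN.branch_unique h1 h2

include hof hD hdim in
/-- **`δ(S) < δ(D)` for every quadratic transform `S` of a non-regular one-dimensional Noetherian
local domain `D` with finite normalization** — the `δ`-invariant of a curve singularity drops
under blowing up (Kollár 2007, §1.4; Krull 1930). [cite: Kollar2007, §1.4 and Thm. 1.101] -/
theorem IsQuadraticTransform.curveDelta_lt (hreg : ¬ IsDiscreteValuationRing D) {S : Subring K}
    (h : IsQuadraticTransform D S) [IsFractionRing S K] : curveDelta S K < curveDelta D K := by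
  classical
  have hFN := isFirstNeighbourhood_quadraticTransform (K := K) hof hD hdim
  haveI := finite_quadraticTransform (K := K) hof hD hdim
  haveI := Fintype.ofFinite {S : Subring K // IsQuadraticTransform D S}
  have hlt := hFN.sum_curveDelta_lt hdim hreg
  haveI := h.isFractionRing_subalgebraOfLE hof
  have hi : curveDelta S K = curveDelta (subalgebraOfLE h.le') K :=
    curveDelta_eq_of_ringEquiv (subalgebraOfLEEquiv h.le').symm K K
  calc curveDelta S K = curveDelta (subalgebraOfLE h.le') K := hi
    _ ≤ ∑ i : {S : Subring K // IsQuadraticTransform D S}, curveDelta (subalgebraOfLE i.2.le') K :=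
        Finset.single_le_sum (f := fun i : {S : Subring K // IsQuadraticTransform D S} =>
          curveDelta (subalgebraOfLE i.2.le') K) (fun i _ => zero_le)
          (Finset.mem_univ (⟨S, h⟩ : {S : Subring K // IsQuadraticTransform D S}))
    _ < curveDelta D K := hlt

end Family

/-! ## A discrete valuation ring has no proper quadratic transform -/

section DVR

variable {D S : Subring K}

/-- **A quadratic transform of a discrete valuation ring is the ring itself**: if `𝔪_D = (π)` and
`S = D[𝔪/x]_𝔫` dominates `D`, then `x` is a uniformizer (otherwise `x⁻¹ ∈ S`), `D[𝔪/x] = D`, and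
`S = D`. [cite: Kollar2007, Lemma 1.99] -/
theorem IsQuadraticTransform.eq_self_of_isDiscreteValuationRing [IsDiscreteValuationRing D]
    (h : IsQuadraticTransform D S) : S = D := by
  obtain ⟨_, x, hx, hx0, hloc, hle, hfrac, hdom⟩ := h
  have hx0' : (x : K) ≠ 0 := fun e => hx0 (Subtype.ext e)
  obtain ⟨ϖ, hϖ⟩ := IsDiscreteValuationRing.exists_irreducible D
  have hmax : maximalIdeal D = Ideal.span {ϖ} := hϖ.maximalIdeal_eq
  have hϖm : ϖ ∈ maximalIdeal D := (mem_maximalIdeal _).mpr hϖ.not_isUnit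
  have hϖ0 : (ϖ : K) ≠ 0 := fun e => hϖ.ne_zero (Subtype.ext e)
  -- `x = d ϖ` with `d` a unit
  obtain ⟨d, hd⟩ := Ideal.mem_span_singleton'.mp (hmax ▸ hx : x ∈ Ideal.span {ϖ})
  have hd0 : (d : K) ≠ 0 := by
    intro e
    apply hx0
    have : d = 0 := Subtype.ext e
    rw [← hd, this, zero_mul]
  have hdunit : IsUnit d := by
    by_contra hdu
    have hπx : ((ϖ : D) : K) / x ∈ S := hle (div_mem_blowupRing _ hϖm)
    have h2 : ((ϖ : D) : K) / x = (d : K)⁻¹ := by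
      rw [← hd, Subring.coe_mul, div_mul_eq_div_div_swap, div_self hϖ0, one_div]
    rw [h2] at hπx
    exact hdu ((isUnit_subring_iff_inv_mem d).mpr ⟨hd0, hdom.2 d d.2 hπx⟩)
  -- hence `𝔪_D = (x)` and `D[𝔪/x] = D`
  have hmx : ∀ y ∈ maximalIdeal D, ∃ e : D, y = e * x := by
    intro y hy
    rw [hmax] at hy
    obtain ⟨e, he⟩ := Ideal.mem_span_singleton'.mp hy
    obtain ⟨u, rfl⟩ := hdunit
    refine ⟨e * ((u⁻¹ : Dˣ) : D), ?_⟩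
    rw [← he, ← hd, mul_assoc, ← mul_assoc ((u⁻¹ : Dˣ) : D), Units.inv_mul, one_mul]
  have hB : blowupRing D (x : K) ≤ D := by
    refine Subring.closure_le.mpr ?_
    rintro z (hz | ⟨y, hy, rfl⟩)
    · exact hz
    · obtain ⟨e, rfl⟩ := hmx y hy
      change ((e * x : D) : K) / x ∈ D
      rw [Subring.coe_mul, mul_div_assoc, div_self hx0', mul_one]
      exact e.2
  apply le_antisymm
  · intro z hz
    obtain ⟨a, ha, b, hb, hbinv, rfl⟩ := hfrac z hz
    rw [div_eq_mul_inv]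
    exact D.mul_mem (hB ha) (hdom.2 b (hB hb) hbinv)
  · exact hdom.1

end DVR

end Literature.AlgebraicGeometry.Resolution
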